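import Summits.SmoothPoincare4.SmoothPoincare4.Theses.WeakReductionDescent
import Literature.Topology.FourManifolds.DependentTripleGenusThreeTrisections
import Literature.Topology.FourManifolds.HomotopyS4CompactProofs
import Literature.Topology.FourManifolds.HomotopyS4OrientableProofs
import Literature.Barriers.SmoothPoincare4.LowGenusTrisectionsStandardProofs

/-!
# SmoothPoincare4 / WeakReductionDescent — `DependentTripleGenusThreeStandard` is exactly the
vendored Aranda–Zupan Thm 1.4 fact

Item stmt-SmoothPoincare4-18000 (`DependentTripleGenusThreeStandard`, support, rank 9 of route
WeakReductionDescent; piece `X_F` of the rung split of the crux `MinimalWeaklyReducible`): a smooth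
homotopy 4-sphere `M` (the Statement's bare binders: Hausdorff, second countable, `C^∞` atlas on
`ℝ⁴`, `e : M ≃ₕ S⁴`) carrying a genus-`3` Gay–Kirby trisection
(`Literature.Topology.FourManifolds.IsGKTrisection M 3 k T`) that admits a DEPENDENT TRIPLE (the
route's inline block: pairwise disjoint non-separating smoothly embedded circles `a, b, c` on the
central surface `F`, bounding properly embedded smooth discs in the handlebodies `H 0`, `H 1`, `H 2`
respectively, with `F ∖ (a ∪ b ∪ c)` disconnected) is diffeomorphic to `S⁴`.

Mathematically this is the homotopy-sphere corollary of Aranda–Zupan 2025, Theorem 1.4 /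
Corollary 1.5 (arXiv:2503.04607, p. 2; proof §7, pp. 24–26), which the tree carries as the UNPROVED
named fact `Literature.Topology.FourManifolds.arandaZupan_dependentTriple_genusThree_homotopySphere`
(file `DependentTripleGenusThreeTrisections.lean`, stated verbatim in the item's shape).

This file records, kernel-checked:

* `dependentTripleGenusThreeStandard_iff_arandaZupan` — the item and the fact are the SAME
  proposition (`Iff.rfl`); `dependentTripleGenusThreeStandard_of_arandaZupan` is the conditional
  closure (D-0014) and `arandaZupan_of_dependentTripleGenusThreeStandard` the converse.  Hence an
  unconditional proof of the item is exactly a formal proof of AZ25 Thm 1.4 (homotopy-sphere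
  corollary) over `IsGKTrisection`; nothing weaker suffices.
* `dependentTripleGenusThreeStandard_of_smoothPoincare` — the item is implied by `SmoothPoincare4`
  itself (shield): it cannot be refuted short of an exotic 4-sphere carrying a genus-`3` trisection
  with a dependent triple.
* `dependentTripleGenusThreeStandard_of_msz_of_balanced` — GIVEN the Meier–Schirmer–Zupan fact
  `Literature.Barriers.SmoothPoincare4.msz_homotopySphere_gk` (already the debt of the sibling rung
  `LowGenusBase`), the item reduces to its balanced case `k = (1,1,1)`: by the PROVED tree theorem
  `eq_one_of_exotic_of_genus_three_of_msz_alone` an exotic genus-`3` trisected homotopy sphere is of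
  type `(3; 1,1,1)`.  So the residual debt of this rung is AZ25 Thm 1.4 for `(3; 1,1,1)`-trisections
  of homotopy spheres with a dependent triple (AZ25 §7, pp. 24–26: cases (1), (2) of Figure 18 are
  weak reductions — case (2) via Lemma 3.8 — and fall under Thm 1.3; case (3), the pants-cobounding
  triple, needs Lemma 3.7, five-chain surgery (Lemma 5.4, Prop. 5.5), [MZ17b] and Lemma 7.1).

What is NOT here: a proof of the fact (AZ25's argument rests on thin position for `(3;1,1,1)`
weak reductions, waves, Heegaard triples, Waldhausen's theorem for `#ᵏ S¹ × S²`, Laudenbach–Poénaru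
and the Meier–Zupan genus-two classification — none of it in Mathlib or the tree).
-/

namespace Summit.SmoothPoincare4.SmoothPoincare4.Theorems

open scoped Manifold ContDiff ContinuousMap
open Summit.SmoothPoincare4.SmoothPoincare4.Theses.WeakReductionDescent

/-- **`DependentTripleGenusThreeStandard` from the Aranda–Zupan fact** (conditional result,
D-0014). The named fact
`Literature.Topology.FourManifolds.arandaZupan_dependentTriple_genusThree_homotopySphere`
(AZ25 Thm 1.4 / Cor 1.5, homotopy-sphere corollary over `IsGKTrisection`) is stated verbatim in the
shape of the route item, so it closes it by `exact`.
[cite: ArandaZupan2025, Thm. 1.4 and Cor. 1.5 (p. 2), §7 (pp. 24–26)] -/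
theorem dependentTripleGenusThreeStandard_of_arandaZupan
    (hAZ : Literature.Topology.FourManifolds.arandaZupan_dependentTriple_genusThree_homotopySphere) :
    DependentTripleGenusThreeStandard := by
  unfold DependentTripleGenusThreeStandard
  intro M _ _ _ _ _ e k T hT hdt
  exact hAZ M e k T hT hdt

/-- **The Aranda–Zupan fact from `DependentTripleGenusThreeStandard`**: the converse direction
(the two propositions have literally the same binders and conclusion).
[cite: ArandaZupan2025, Thm. 1.4 and Cor. 1.5 (p. 2)] -/
theorem arandaZupan_of_dependentTripleGenusThreeStandard (h : DependentTripleGenusThreeStandard) :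
    Literature.Topology.FourManifolds.arandaZupan_dependentTriple_genusThree_homotopySphere := by
  intro M _ _ _ _ _ e k T hT hdt
  exact h M e k T hT hdt

/-- **`DependentTripleGenusThreeStandard` is, definitionally, the vendored Aranda–Zupan Thm 1.4
fact.** Consequently an unconditional proof of item stmt-SmoothPoincare4-18000 is the same thing
as discharging `arandaZupan_dependentTriple_genusThree_homotopySphere`
(`theorem …_holds`), and conversely. [cite: ArandaZupan2025, Thm. 1.4 and Cor. 1.5 (p. 2)] -/
theorem dependentTripleGenusThreeStandard_iff_arandaZupan :
    DependentTripleGenusThreeStandard ↔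
      Literature.Topology.FourManifolds.arandaZupan_dependentTriple_genusThree_homotopySphere :=
  Iff.rfl

/-- **Shield: `SmoothPoincare4` implies `DependentTripleGenusThreeStandard`.** The item's
conclusion is an instance of the summit statement (every smooth homotopy 4-sphere over the bare
binders is diffeomorphic to `S⁴`); the trisection and the dependent triple are not even used. So the
item can only be refuted by an exotic 4-sphere (carrying a genus-`3` GK-trisection with a dependent
triple), i.e. by refuting `SmoothPoincare4` itself. [folklore] -/
theorem dependentTripleGenusThreeStandard_of_smoothPoincare (hS : SmoothPoincare4) :
    DependentTripleGenusThreeStandard := by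
  unfold DependentTripleGenusThreeStandard
  intro M _ _ _ cs im e _k _T _hT _hdt
  exact hS M cs im e

/-- **Modulo MSZ, only the balanced type `(3; 1,1,1)` carries content.** GIVEN the
Meier–Schirmer–Zupan fact `Literature.Barriers.SmoothPoincare4.msz_homotopySphere_gk` (the debt the
route already owes for `LowGenusBase`), `DependentTripleGenusThreeStandard` follows from its
restriction `hbal` to trisections of type `(3; 1,1,1)` (`k = fun _ => 1`, same inline
dependent-triple block): if a genus-`3` GK-trisected smooth homotopy 4-sphere `M` were not
diffeomorphic to `S⁴`, then `M` is compact (Hatcher Prop. 3.29,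
`compactSpace_of_homotopyEquiv_sphere_four_holds`), simply connected hence connected, and orientable
(`isOrientable_of_homotopyEquiv_sphere_four_holds`), so by the PROVED tree theorem
`eq_one_of_exotic_of_genus_three_of_msz_alone` (MSZ + the proved Euler identity `g = k₀ + k₁ + k₂`)
every `kᵢ = 1`, and `hbal` applies. So this rung's named-fact debt is `msz_homotopySphere_gk` plus
Aranda–Zupan Thm 1.4 for `(3; 1,1,1)`-trisections of homotopy spheres with a dependent triple.
[cite: ArandaZupan2025, Thm. 1.4 (p. 2) and §7 (pp. 24–26)]
[cite: MeierSchirmerZupan2016, Thm. 1.2 and Remark 3.12] -/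
theorem dependentTripleGenusThreeStandard_of_msz_of_balanced
    (hMSZ : Literature.Barriers.SmoothPoincare4.msz_homotopySphere_gk.{0})
    (hbal : ∀ (M : Type) [TopologicalSpace M] [T2Space M] [SecondCountableTopology M]
      [ChartedSpace (EuclideanSpace ℝ (Fin 4)) M] [IsManifold (𝓡 4) ((⊤ : ℕ∞) : WithTop ℕ∞) M],
      (M ≃ₕ (Metric.sphere (0 : EuclideanSpace ℝ (Fin 5)) 1)) → ∀ (T : Fin 3 → Set M),
      Literature.Topology.FourManifolds.IsGKTrisection M 3 (fun _ => 1) T →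
      (let F : Set M := ⋂ l, T l
       let H : Fin 3 → Set M := fun p => ⋂ (l : Fin 3) (_ : l ≠ p), T l
       let IsCurve : Set M → Prop := fun c => c ⊆ F ∧
         ∃ γ : (Metric.sphere (0 : EuclideanSpace ℝ (Fin 2)) 1) → M,
           Manifold.IsSmoothEmbedding (𝓡 1) (𝓡 4) ((⊤ : ℕ∞) : WithTop ℕ∞) γ ∧ Set.range γ = c
       let BoundsDisc : Set M → Set M → Prop := fun A c =>
         ∃ d : (Metric.closedBall (0 : EuclideanSpace ℝ (Fin 2)) 1) → M,
           Manifold.IsSmoothEmbedding (𝓡∂ 2) (𝓡 4) ((⊤ : ℕ∞) : WithTop ℕ∞) d ∧ Set.range d ⊆ A ∧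
           d '' ((𝓡∂ 2).boundary (Metric.closedBall (0 : EuclideanSpace ℝ (Fin 2)) 1)) = c ∧
           Set.range d ∩ F = c
       let NonSep : Set M → Prop := fun c => IsConnected (F \ c)
       ∃ (a b c : Set M), IsCurve a ∧ IsCurve b ∧ IsCurve c ∧
         Disjoint a b ∧ Disjoint b c ∧ Disjoint a c ∧ NonSep a ∧ NonSep b ∧ NonSep c ∧
         BoundsDisc (H 0) a ∧ BoundsDisc (H 1) b ∧ BoundsDisc (H 2) c ∧
         ¬ IsPreconnected (F \ (a ∪ b ∪ c))) →
      Nonempty (Diffeomorph (𝓡 4) (𝓡 4) M (Metric.sphere (0 : EuclideanSpace ℝ (Fin 5)) 1)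
        ((⊤ : ℕ∞) : WithTop ℕ∞))) :
    DependentTripleGenusThreeStandard := by
  unfold DependentTripleGenusThreeStandard
  intro M _ _ _ _ _ e k T hT hdt
  by_contra hE
  haveI hE' : IsEmpty (Diffeomorph (𝓡 4) (𝓡 4) M (Metric.sphere (0 : EuclideanSpace ℝ (Fin 5)) 1)
      ((⊤ : ℕ∞) : WithTop ℕ∞)) := not_nonempty_iff.mp hE
  haveI : CompactSpace M :=
    Literature.Topology.FourManifolds.compactSpace_of_homotopyEquiv_sphere_four_holds M e
  haveI : SimplyConnectedSpace (Metric.sphere (0 : EuclideanSpace ℝ (Fin 5)) 1) :=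
    Literature.Topology.FourManifolds.simplyConnectedSpace_sphere_four_holds
  haveI : SimplyConnectedSpace M := e.simplyConnectedSpace
  obtain ⟨o⟩ :=
    Literature.Topology.FourManifolds.isOrientable_of_homotopyEquiv_sphere_four_holds M e
  have hk : k = fun _ => 1 := funext fun i =>
    Literature.Barriers.SmoothPoincare4.eq_one_of_exotic_of_genus_three_of_msz_alone
      hMSZ M o hT e hE' i
  subst hk
  exact hE (hbal M e T hT hdt)

end Summit.SmoothPoincare4.SmoothPoincare4.Theorems
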